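import Summits.PneNP.PneNP.Theorems.ChebyshevTracialDesignNonCrossingCellDesign
import HarnessLib

/-!
# Cell pnp-psdrank, route `ChebyshevTracialDesign`: the PIECES of the NON-TIGHT-FREE `r = 1` rung — one Kupavskii–Zakharov piece at a time,
# one-sidedly, for an arbitrary rectangle

Harmonic backbone of the crux `TracialDecayExp20` (stmt-PneNP-19878), brick 49 (prover g10; NTF mod KL, MEMO-12 §3 «next prover (0)»). Brick 31
(`…RungPieces.abs_piece_value_le`) bounds `|Σ_{A × Y_i} W|` for a TIGHT-FREE rectangle, the non-crossing cells being junk by the SNT contradiction.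
Here the rectangle is ARBITRARY and the bound is ONE-SIDED: with `Y_i` the `i`-th Kupavskii–Zakharov piece (core `S_i`, `|S_i| ≤ q`),
* §1 **`noncrossing_cell_le`** — a non-crossing cell `A_π × Y_i` equals `ρ_π(0)` times the reduced rectangle `Ã × Ỹ` of `K_m` evaluated against the
  REDUCED DESIGN `w'_c = w_c ρ_π(c)/ρ_π(0)` (brick 48: exact of degree `D − |S_i|`, variation `≤ B`), so any bound `B·Φ` valid for all such designs on
  `Ã × Ỹ` gives `cell ≤ 2·(|PM_m|/|PM_n|)·B·Φ` (`ρ_π(0) ≤ 2|PM_m|/|PM_n|`, `2q² + q ≤ n/2`);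
* §2 **`piece_value_le`** — `Σ_{U∈A} Σ_{M∈Y_i} W(U,M) ≤ 4^q·B·√P_{D−4} + 2·4^q·(|⟨S_i⟩|/|PM_n|)·B·(Ψ + β)`: crossing cells by the crossing-pin lemma
  (brick 30 `abs_crossing_cell_le`, unchanged), non-crossing cells by §1 and the DICHOTOMY — both reduced densities `≥ exp(−c₀ dq m)` ⇒ the
  spread-cell bound `B·Ψ` (hypothesis `hVNS`, supplied by bricks 46/47 in the assembly), else the uniform marginals give `≤ B·β`.
[cite: Rothvoss2017, §2 (PDF p. 6)] [cite: KupavskiiZakharov2022, §2 and Lemma 11] [cite: KeevashLifshitz2023, Thm. 1.8]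
Stature: support/instrument (no defs). WHAT THIS IS NOT: not NTF (the sum over pieces and the constants are the next file), nothing on psd rank,
no P-vs-NP content. Supports stmt-PneNP-19878.
-/

set_option linter.dupNamespace false -- `Summit.PneNP.PneNP.…`: summit = sub-problem (D-0017)

noncomputable section

namespace Summit.PneNP.PneNP.Theorems.ChebyshevTracialDesignRungPiecesOneSided

open Finset Polynomial Literature.Combinatorics.Optimization
open Literature.Barriers.PneNP hiding verts
open Literature.Combinatorics.SetFamily
open Literature.Combinatorics.SimpleGraph.CycleSpace
open Literature.Combinatorics.AssociationSchemes.CutMatchingRestriction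
open Literature.Combinatorics.AssociationSchemes.HomogeneousMatchingFamilies
open Summit.PneNP.PneNP.Theorems.ChebyshevTracialDesignProfilePolynomial (card_pmatch_pos)
open Summit.PneNP.PneNP.Theorems.ChebyshevTracialDesignDipoleHitRatio (card_pmatch_eq_pmCount)
open Summit.PneNP.PneNP.Theorems.ChebyshevTracialDesignRungCells
open Summit.PneNP.PneNP.Theorems.ChebyshevTracialDesignRungPieces
open Summit.PneNP.PneNP.Theorems.ChebyshevTracialDesignNonCrossingCellDesign

variable {n : ℕ}

/-! ### §1 A non-crossing cell through the reduced design -/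

/-- **A non-crossing cell, one-sidedly, through the reduced design.** Let `n` be even, `(n, t = 2c'+1, T, D, B, C, w)` an exact design, `S` a perfect
matching of `V` with `|V| = 2s`, `T + 2s + 2 ≤ t`, `s ≤ D`, `2s² + s ≤ n/2`, `π ⊆ V` a non-crossing pattern, `|univ ∖ V| = m`, `A` a family of
`t`-cuts and `B` a set of perfect matchings containing `S`. If for EVERY weight `w'` on the levels `C` that is exact of degree `D − s` with
`Σ|w'_c| ≤ B` the reduced rectangle satisfies `Σ_{Ã × B̃} levelWeight m (t − |π|) C w' ≤ B·Φ` (given that the level classes `Q_c(m, t−|π|)`,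
`c ∈ C`, are nonempty), then `Σ_{U∈A, U∩V=π} Σ_{M∈B} W(U,M) ≤ 2·(|PM_m|/|PM_n|)·B·Φ`. [cite: Rothvoss2017, §2 (PDF p. 6)]
[cite: KupavskiiZakharov2022, §2] -/
theorem noncrossing_cell_le {c' T Dg m s : ℕ} {Bv Φ : ℝ} {C : Finset ℕ} {w : ℕ → ℝ} (hn : Even n)
    (hdes : IsExactDesign n (2 * c' + 1) T Dg Bv C w) {V π : Finset (Fin n)} {S : Finset (Sym2 (Fin n))} (hS : IsPMOn V S)
    (hVs : V.card = 2 * s) (hTs : T + 2 * s + 2 ≤ 2 * c' + 1) (hsD : s ≤ Dg) (hsN : 2 * s * s + s ≤ n / 2)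
    (hπ0 : crossCount π S = 0) (hπV : π ⊆ V) (h : (univ \ V).card = m)
    (A : Finset (OddSet n)) (B : Finset (PMatch n)) (hB : ∀ M ∈ B, S ⊆ M.1) (hΦ : 0 ≤ Φ)
    (hred : (∀ c ∈ C, (Qset m (2 * c' + 1 - π.card) c).Nonempty) → ∀ w' : ℕ → ℝ,
      (∀ p : Polynomial ℝ, p.natDegree ≤ Dg - s → ∑ c ∈ C, w' c * p.eval (c : ℝ) = -p.eval 0) →
      ∑ c ∈ C, |w' c| ≤ Bv →
      ∑ U ∈ oddCellCuts A V π h, ∑ M ∈ pmCellMatchings B V S h, levelWeight m (2 * c' + 1 - π.card) C w' U M ≤ Bv * Φ) :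
    ∑ U ∈ A.filter (fun U => U.1 ∩ V = π), ∑ M ∈ B, levelWeight n (2 * c' + 1) C w U M ≤
      2 * ((Fintype.card (PMatch m) : ℝ) / Fintype.card (PMatch n)) * (Bv * Φ) := by
  classical
  have ht2 : 2 * (2 * c' + 1) + 2 ≤ n := hdes.2.1
  have hTt : T ≤ 2 * c' + 1 := hdes.2.2.1
  have hC := hdes.2.2.2.1
  have hexact := hdes.2.2.2.2.2.1
  have hBvar := hdes.2.2.2.2.2.2
  have hBv : 0 ≤ Bv := (sum_nonneg fun c _ => abs_nonneg (w c)).trans hBvar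
  obtain ⟨N, hN⟩ := hn
  have hN2 : n / 2 = N := by omega
  -- `π` is a union of edges of `S`: even, of size `2p₁ ≤ 2s`
  have hπe : Even π.card := by
    have := even_card_inter_of_crossCount_eq_zero hS hπ0
    rwa [inter_eq_left.2 hπV] at this
  obtain ⟨p₁, hp₁⟩ := hπe
  have hπcard : π.card = 2 * p₁ := by omega
  have hp₁s : p₁ ≤ s := by have := card_le_card hπV; omega
  have hVn : V.card ≤ n := by simpa using card_le_univ V
  have hms : m + 2 * s = n := by rw [← h, card_univ_sdiff, Fintype.card_fin]; omega
  have hmeven : Even m := ⟨N - s, by omega⟩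
  have ht'' : 2 * c' + 1 - π.card = 2 * (c' - p₁) + 1 := by omega
  have hPMn : (0 : ℝ) < Fintype.card (PMatch n) := by exact_mod_cast card_pmatch_pos ⟨N, hN⟩
  have hPMm : (0 : ℝ) < Fintype.card (PMatch m) := by exact_mod_cast card_pmatch_pos hmeven
  have hprodN : 0 < ∏ j ∈ range s, (((n / 2 : ℕ) : ℝ) - j) := by
    refine prod_pos fun j hj => ?_
    have := mem_range.1 hj
    have : (j : ℝ) < ((n / 2 : ℕ) : ℝ) := by exact_mod_cast (show j < n / 2 by nlinarith)
    linarith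
  -- the class-ratio polynomial
  set κ₀ : ℝ := ((Fintype.card (PMatch m) : ℝ) / Fintype.card (PMatch n)) / ∏ j ∈ range s, (((n / 2 : ℕ) : ℝ) - j) with hκ₀
  have hκ₀pos : 0 < κ₀ := by rw [hκ₀]; positivity
  set a : ℝ := ((n : ℝ) - (2 * c' + 1 : ℕ)) / 2 with ha
  set b : ℝ := (((2 * c' + 1 : ℕ) : ℝ)) / 2 with hb
  set ρ : Polynomial ℝ := Polynomial.C κ₀ * (∏ j ∈ range (s - p₁), (Polynomial.C (a - j) - Polynomial.C (1 / 2 : ℝ) * X)) *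
    ∏ j ∈ range p₁, (Polynomial.C (b - j) - Polynomial.C (1 / 2 : ℝ) * X) with hρ
  have hρdeg : ρ.natDegree ≤ s := natDegree_cellRatio_le κ₀ a b s p₁ hp₁s
  have hρeval : ∀ x : ℝ, ρ.eval x = κ₀ * (∏ j ∈ range (s - p₁), (a - x / 2 - j)) * ∏ j ∈ range p₁, (b - x / 2 - j) :=
    fun x => eval_cellRatio κ₀ a b s p₁ x
  -- positivity / monotonicity on `[0, T]`
  have hposle : ∀ x : ℝ, 0 ≤ x → x ≤ T → 0 < ρ.eval x ∧ ρ.eval x ≤ ρ.eval 0 := by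
    intro x hx0 hxT
    rw [hρeval, hρeval]
    refine cellRatio_eval_pos_le hκ₀pos hx0 ?_ ?_
    · rw [ha, Nat.cast_sub hp₁s]
      have : (T : ℝ) + 2 * s + 2 ≤ (2 * c' + 1 : ℕ) := by exact_mod_cast hTs
      have : (2 * ((2 * c' + 1 : ℕ) : ℝ)) + 2 ≤ n := by exact_mod_cast ht2
      linarith
    · rw [hb]
      have : (T : ℝ) + 2 * s + 2 ≤ (2 * c' + 1 : ℕ) := by exact_mod_cast hTs
      have : (p₁ : ℝ) ≤ s := by exact_mod_cast hp₁s
      linarith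
  have hρ0 : 0 < ρ.eval 0 := (hposle 0 le_rfl (Nat.cast_nonneg T)).1
  -- the identity `|Q''_c| = ρ(c)|Q_c|` on the design levels
  have hratio : ∀ c ∈ C, ((Qset m (2 * c' + 1 - π.card) c).card : ℝ) = ρ.eval (c : ℝ) * (Qset n (2 * c' + 1) c).card := by
    intro c hc
    obtain ⟨⟨m₁, hm₁⟩, -, hcT, -⟩ := hC c hc
    rw [ht'', hm₁, hρ, ha, hb]
    exact cellRatio_eq_eval ⟨N, hN⟩ hms hp₁s (by omega) (by omega)
  -- `ρ(0) ≤ 2 |PM_m|/|PM_n|`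
  have hρ0le : ρ.eval 0 ≤ 2 * ((Fintype.card (PMatch m) : ℝ) / Fintype.card (PMatch n)) := by
    rw [hρeval, hκ₀, mul_assoc, div_mul_eq_mul_div, div_le_iff₀ hprodN]
    have hN2R : (((n / 2 : ℕ) : ℝ)) = (n : ℝ) / 2 := by
      rw [hN2]
      have hnR : (n : ℝ) = N + N := by exact_mod_cast hN
      rw [hnR]; ring
    have haN : a ≤ ((n / 2 : ℕ) : ℝ) := by
      rw [ha, hN2R]
      have : (0 : ℝ) ≤ ((2 * c' + 1 : ℕ) : ℝ) := Nat.cast_nonneg _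
      linarith
    have hbN : b ≤ ((n / 2 : ℕ) : ℝ) := by
      rw [hb, hN2R]
      have : (2 * ((2 * c' + 1 : ℕ) : ℝ)) + 2 ≤ n := by exact_mod_cast ht2
      linarith
    have hcore := cellRatio_zero_core_le (N := n / 2) (s := s) (p₁ := p₁) (a := a) (b := b) hp₁s hsN haN hbN
      (fun j hj => by
        have := mem_range.1 hj
        rw [ha]
        have h1 : (j : ℝ) + 1 ≤ ((s - p₁ : ℕ) : ℝ) := by exact_mod_cast this
        rw [Nat.cast_sub hp₁s] at h1
        have : (T : ℝ) + 2 * s + 2 ≤ (2 * c' + 1 : ℕ) := by exact_mod_cast hTs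
        have : (2 * ((2 * c' + 1 : ℕ) : ℝ)) + 2 ≤ n := by exact_mod_cast ht2
        linarith)
      (fun j hj => by
        have := mem_range.1 hj
        rw [hb]
        have h1 : (j : ℝ) + 1 ≤ (p₁ : ℝ) := by exact_mod_cast this
        have : (T : ℝ) + 2 * s + 2 ≤ (2 * c' + 1 : ℕ) := by exact_mod_cast hTs
        have : (p₁ : ℝ) ≤ s := by exact_mod_cast hp₁s
        linarith)
    calc (Fintype.card (PMatch m) : ℝ) / Fintype.card (PMatch n) *
          ((∏ j ∈ range (s - p₁), (a - 0 / 2 - j)) * ∏ j ∈ range p₁, (b - 0 / 2 - j))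
        ≤ (Fintype.card (PMatch m) : ℝ) / Fintype.card (PMatch n) * (2 * ∏ j ∈ range s, (((n / 2 : ℕ) : ℝ) - j)) :=
          mul_le_mul_of_nonneg_left hcore (by positivity)
      _ = _ := by ring
  -- nonempty reduced level classes
  have hQn : ∀ c ∈ C, (Qset n (2 * c' + 1) c).Nonempty := fun c hc => (hC c hc).2.2.2
  have hQm : ∀ c ∈ C, (Qset m (2 * c' + 1 - π.card) c).Nonempty := by
    intro c hc
    obtain ⟨-, -, hcT, hne⟩ := hC c hc
    have hpos : (0 : ℝ) < (Qset m (2 * c' + 1 - π.card) c).card := by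
      rw [hratio c hc]
      exact mul_pos (hposle c (Nat.cast_nonneg c) (by exact_mod_cast hcT)).1 (by exact_mod_cast card_pos.2 hne)
    exact card_pos.1 (by exact_mod_cast hpos)
  -- the reduced design
  set w' : ℕ → ℝ := fun c => w c * ρ.eval (c : ℝ) / ρ.eval 0 with hw'
  have hexact' : ∀ p : Polynomial ℝ, p.natDegree ≤ Dg - s → ∑ c ∈ C, w' c * p.eval (c : ℝ) = -p.eval 0 :=
    reducedDesign_exact hsD hexact ρ hρdeg hρ0.ne'
  have hvar' : ∑ c ∈ C, |w' c| ≤ Bv := by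
    refine (reducedDesign_variation_le ρ hρ0 fun c hc => ?_).trans hBvar
    obtain ⟨-, -, hcT, -⟩ := hC c hc
    have h := hposle c (Nat.cast_nonneg c) (by exact_mod_cast hcT)
    exact ⟨h.1.le, h.2⟩
  -- value identity and the bound
  rw [noncrossing_cell_eq_reduced_value C w hS hπ0 hπV (by omega) h A B hB ρ hρ0.ne' hratio hQn]
  have hval := hred hQm w' hexact' hvar'
  calc ρ.eval 0 * ∑ U ∈ oddCellCuts A V π h, ∑ M ∈ pmCellMatchings B V S h, levelWeight m (2 * c' + 1 - π.card) C w' U M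
      ≤ ρ.eval 0 * (Bv * Φ) := mul_le_mul_of_nonneg_left hval hρ0.le
    _ ≤ 2 * ((Fintype.card (PMatch m) : ℝ) / Fintype.card (PMatch n)) * (Bv * Φ) :=
        mul_le_mul_of_nonneg_right hρ0le (mul_nonneg hBv hΦ)

/-! ### §2 One piece of the spread approximation, one-sidedly -/

set_option maxHeartbeats 400000 in
/-- **The value of an ARBITRARY rectangle on one Kupavskii–Zakharov piece, one-sidedly.** Let `n` be even, `(n, t = 2c'+1, T, D, B, C, w)` an exact
design with `4 ≤ D ≤ 2c'`, `n ≤ 4t`, `T + 2q + 2 ≤ t`, `q ≤ D`, `2q² + q ≤ n/2`, `A` a family of `t`-cuts, `Y` ANY set of perfect matchings, `Dk` a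
spread approximation of the edge sets of `Y` (parameter `τ`, cores `≤ q`, `40q ≤ n`), `i` one of its pieces. Assume the spread-cell bound in every
reduced instance `K_m`, `n − 2q ≤ m ≤ n` (hypothesis `hVNS`: dense `t''`-cuts against a dense `(PM_m,τ)`-homogeneous family have value `≤ B·Ψ`
for every reduced design of degree `D' ∈ [D − q, D]` on the levels `C`; threshold `exp(−c₀ dq m) ≤ β`). Then
`Σ_{U∈A} Σ_{M∈Y_i} W(U,M) ≤ 4^q·B·√P_{D−4} + 2·4^q·(|⟨S_i⟩|/|PM_n|)·B·(Ψ + β)`.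
[cite: Rothvoss2017, §2 (PDF p. 6)] [cite: KupavskiiZakharov2022, Lemma 11] [cite: KeevashLifshitz2023, Thm. 1.8] -/
theorem piece_value_le {c' T Dg q n₁ : ℕ} {Bv τ c₀ β Ψ : ℝ} {C : Finset ℕ} {w : ℕ → ℝ} (hn : Even n)
    (hdes : IsExactDesign n (2 * c' + 1) T Dg Bv C w) (hDg : Dg ≤ 2 * c') (hDg4 : 4 ≤ Dg)
    (hbal : n ≤ 4 * (2 * c' + 1)) (hq : 40 * q ≤ n) (hn₁ : n₁ + 2 * q ≤ n)
    (hTq : T + 2 * q + 2 ≤ 2 * c' + 1) (hqD : q ≤ Dg) (hDq3 : Dg + 2 * q + 3 ≤ 2 * c' + 1) (hqN : 2 * q * q + q ≤ n / 2)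
    (hVNS : ∀ (m t'' D' : ℕ) (w' : ℕ → ℝ), n₁ ≤ m → Even m → Odd t'' → m ≤ 5 * t'' → m ≤ 5 * (m - t'') →
      T ≤ t'' → T ≤ m - t'' → D' + 3 ≤ t'' → D' + 3 ≤ m - t'' → Dg ≤ D' + q → D' ≤ Dg →
      (∀ c ∈ C, (Qset m t'' c).Nonempty) →
      (∀ p : Polynomial ℝ, p.natDegree ≤ D' → ∑ c ∈ C, w' c * p.eval (c : ℝ) = -p.eval 0) →
      ∑ c ∈ C, |w' c| ≤ Bv →
      ∀ (X : Finset (OddSet m)), (∀ U ∈ X, U.1.card = t'') →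
      ∀ (Y' : Finset (PMatch m)), IsRelHomogeneous τ (perfectMatchings (univ : Finset (Fin m))) (Y'.image Subtype.val) →
      Real.exp (-(c₀ * dq m)) ≤ (X.card : ℝ) / (m.choose t'' : ℝ) →
      Real.exp (-(c₀ * dq m)) ≤ (Y'.card : ℝ) / (Fintype.card (PMatch m) : ℝ) →
      ∑ U ∈ X, ∑ M ∈ Y', levelWeight m t'' C w' U M ≤ Bv * Ψ)
    (hΨ : 0 ≤ Ψ) (hβ : ∀ m : ℕ, n ≤ m + 2 * q → m ≤ n → Real.exp (-(c₀ * dq m)) ≤ β) (hβ0 : 0 ≤ β)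
    (A : Finset (OddSet n)) (hA : ∀ U ∈ A, U.1.card = 2 * c' + 1) (Y : Finset (PMatch n))
    (Dk : SpreadApproximation (perfectMatchings (univ : Finset (Fin n))) (Y.image Subtype.val) τ q) (i : Fin Dk.k) :
    ∑ U ∈ A, ∑ M ∈ Y.filter (fun M => M.1 ∈ Dk.piece i), levelWeight n (2 * c' + 1) C w U M ≤
      (4 : ℝ) ^ q * (Bv * Real.sqrt (∏ j ∈ range ((Dg - 4) / 2 + 1), ((2 * j + 1 : ℝ) / ((n : ℝ) - 2 * j)))) +
        2 * (4 : ℝ) ^ q * (((supersets (perfectMatchings (univ : Finset (Fin n))) (Dk.core i)).card : ℝ) / Fintype.card (PMatch n)) *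
          (Bv * (Ψ + β)) := by
  classical
  have hS : IsPMOn (verts (Dk.core i)) (Dk.core i) := isPMOn_verts_core (image_val_subset Y) Dk i
  have hBiS : ∀ M ∈ Y.filter (fun M => M.1 ∈ Dk.piece i), Dk.core i ⊆ M.1 :=
    fun M hM => Dk.core_subset_of_mem_piece (mem_filter.1 hM).2
  have hVcard : (verts (Dk.core i)).card = 2 * (Dk.core i).card := hS.two_mul_card.symm
  have hSq : (Dk.core i).card ≤ q := Dk.card_core_le i
  have hVn : (verts (Dk.core i)).card ≤ n := by simpa using card_le_univ (verts (Dk.core i))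
  have hm : (univ \ verts (Dk.core i)).card = n - (verts (Dk.core i)).card := by rw [card_univ_sdiff, Fintype.card_fin]
  have hBv : 0 ≤ Bv := (sum_nonneg fun c _ => abs_nonneg (w c)).trans hdes.2.2.2.2.2.2
  have ht2 : 2 * (2 * c' + 1) + 2 ≤ n := hdes.2.1
  have hPM : (0 : ℝ) < Fintype.card (PMatch n) := by exact_mod_cast card_pmatch_pos hn
  have hCn : (0 : ℝ) < (n.choose (2 * c' + 1) : ℝ) := by exact_mod_cast Nat.choose_pos (by omega)
  set P : ℝ := ∏ j ∈ range ((Dg - 4) / 2 + 1), ((2 * j + 1 : ℝ) / ((n : ℝ) - 2 * j)) with hPdef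
  have hP0 : 0 ≤ P :=
    prod_nonneg fun j hj => (Summit.PneNP.PneNP.Theorems.ChebyshevTracialDesignLevelTail.atten_factor_le_one
      (by have := mem_range.1 hj; omega)).1
  -- the star density of the core equals `|PM_m|/|PM_n|`
  set m := n - (verts (Dk.core i)).card with hmdef
  have hstar : ((supersets (perfectMatchings (univ : Finset (Fin n))) (Dk.core i)).card : ℝ) / Fintype.card (PMatch n) =
      (Fintype.card (PMatch m) : ℝ) / Fintype.card (PMatch n) := by
    rw [card_supersets_perfectMatchings_eq hS, card_pmatch_eq_pmCount (n := m)]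
  -- split by patterns
  rw [sum_eq_sum_patterns A (verts (Dk.core i))]
  rw [← sum_filter_add_sum_filter_not (verts (Dk.core i)).powerset (fun π => crossCount π (Dk.core i) = 0)]
  -- NON-CROSSING patterns
  have hnc : ∑ π ∈ (verts (Dk.core i)).powerset.filter (fun π => crossCount π (Dk.core i) = 0),
      ∑ U ∈ A.filter (fun U => U.1 ∩ verts (Dk.core i) = π), ∑ M ∈ Y.filter (fun M => M.1 ∈ Dk.piece i),
        levelWeight n (2 * c' + 1) C w U M ≤
      2 * (4 : ℝ) ^ q * (((supersets (perfectMatchings (univ : Finset (Fin n))) (Dk.core i)).card : ℝ) / Fintype.card (PMatch n)) *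
        (Bv * (Ψ + β)) := by
    have hcell : ∀ π ∈ (verts (Dk.core i)).powerset.filter (fun π => crossCount π (Dk.core i) = 0),
        ∑ U ∈ A.filter (fun U => U.1 ∩ verts (Dk.core i) = π), ∑ M ∈ Y.filter (fun M => M.1 ∈ Dk.piece i),
          levelWeight n (2 * c' + 1) C w U M ≤ 2 * ((Fintype.card (PMatch m) : ℝ) / Fintype.card (PMatch n)) * (Bv * (Ψ + β)) := by
      intro π hπ
      obtain ⟨hπV, hπ0⟩ := mem_filter.1 hπ
      have hπV' : π ⊆ verts (Dk.core i) := mem_powerset.1 hπV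
      refine noncrossing_cell_le (s := (Dk.core i).card) hn hdes hS hVcard (by omega) (by omega)
        (by nlinarith) hπ0 hπV' hm A _ hBiS (add_nonneg hΨ hβ0) ?_
      -- the dichotomy in the reduced instance
      intro hQm w' hexact' hvar'
      have hπcard : π.card ≤ 2 * q := (card_le_card hπV').trans (by omega)
      have hπe : Even π.card := by
        have := even_card_inter_of_crossCount_eq_zero hS hπ0
        rwa [inter_eq_left.2 hπV'] at this
      have hodd : Odd (2 * c' + 1 - π.card) := by obtain ⟨r, hr⟩ := hπe; exact ⟨c' - r, by omega⟩
      have hmq : n ≤ m + 2 * q := by omega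
      have hmn : m ≤ n := Nat.sub_le _ _
      have hβm := hβ m hmq hmn
      have hevm : Even m := by obtain ⟨r, hr⟩ := hn; exact ⟨r - (Dk.core i).card, by omega⟩
      obtain ⟨hhom, -⟩ := isRelHomogeneous_pmCellMatchings_piece Y Dk i hm
      set X' := oddCellCuts A (verts (Dk.core i)) π hm with hX'
      set Y' := pmCellMatchings (Y.filter fun M => M.1 ∈ Dk.piece i) (verts (Dk.core i)) (Dk.core i) hm with hY'
      have hX't : ∀ U ∈ X', U.1.card = 2 * c' + 1 - π.card := fun U hU => card_of_mem_oddCellCuts hA hU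
      have hvar0 : 0 ≤ ∑ c ∈ C, |w' c| := sum_nonneg fun c _ => abs_nonneg _
      -- marginal bounds
      have hcol : ∑ U ∈ X', ∑ M ∈ Y', levelWeight m (2 * c' + 1 - π.card) C w' U M ≤
          Bv * ((Y'.card : ℝ) / Fintype.card (PMatch m)) :=
        (le_abs_self _).trans ((abs_sum_sum_levelWeight_le_col _ C w' X' Y').trans
          (mul_le_mul_of_nonneg_right hvar' (by positivity)))
      have hrow : ∑ U ∈ X', ∑ M ∈ Y', levelWeight m (2 * c' + 1 - π.card) C w' U M ≤
          Bv * ((X'.card : ℝ) / (m.choose (2 * c' + 1 - π.card) : ℝ)) := by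
        rw [sum_sum_levelWeight_eq_sum_mu]
        have hmu : ∀ c ∈ C, mu m (2 * c' + 1 - π.card) c X' Y' ≤ (X'.card : ℝ) / (m.choose (2 * c' + 1 - π.card) : ℝ) := by
          intro c _
          have h1 := mu_le_row (n := m) (2 * c' + 1 - π.card) c X' Y'
          rwa [filter_true_of_mem hX't, card_tcuts_eq_choose hodd] at h1
        calc ∑ c ∈ C, w' c * mu m (2 * c' + 1 - π.card) c X' Y'
            ≤ ∑ c ∈ C, |w' c| * ((X'.card : ℝ) / (m.choose (2 * c' + 1 - π.card) : ℝ)) :=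
              sum_le_sum fun c hc => by
                calc w' c * mu m (2 * c' + 1 - π.card) c X' Y' ≤ |w' c| * mu m (2 * c' + 1 - π.card) c X' Y' :=
                      mul_le_mul_of_nonneg_right (le_abs_self _) (mu_nonneg _ c X' Y')
                  _ ≤ |w' c| * ((X'.card : ℝ) / (m.choose (2 * c' + 1 - π.card) : ℝ)) :=
                      mul_le_mul_of_nonneg_left (hmu c hc) (abs_nonneg _)
          _ = (∑ c ∈ C, |w' c|) * ((X'.card : ℝ) / (m.choose (2 * c' + 1 - π.card) : ℝ)) := by rw [sum_mul]
          _ ≤ Bv * ((X'.card : ℝ) / (m.choose (2 * c' + 1 - π.card) : ℝ)) := mul_le_mul_of_nonneg_right hvar' (by positivity)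
      by_cases hdX : Real.exp (-(c₀ * dq m)) ≤ (X'.card : ℝ) / (m.choose (2 * c' + 1 - π.card) : ℝ)
      · by_cases hdY : Real.exp (-(c₀ * dq m)) ≤ (Y'.card : ℝ) / (Fintype.card (PMatch m) : ℝ)
        · -- dense × dense: the spread-cell bound
          have hv := hVNS m (2 * c' + 1 - π.card) (Dg - (Dk.core i).card) w' (by omega) hevm hodd (by omega) (by omega)
            (by omega) (by omega) (by omega) (by omega) (by omega) (by omega) hQm hexact' hvar' X' hX't Y' hhom hdX hdY
          exact hv.trans (mul_le_mul_of_nonneg_left (by linarith) hBv)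
        · push Not at hdY
          calc _ ≤ Bv * ((Y'.card : ℝ) / Fintype.card (PMatch m)) := hcol
            _ ≤ Bv * β := mul_le_mul_of_nonneg_left (hdY.le.trans hβm) hBv
            _ ≤ Bv * (Ψ + β) := mul_le_mul_of_nonneg_left (by linarith) hBv
      · push Not at hdX
        calc _ ≤ Bv * ((X'.card : ℝ) / (m.choose (2 * c' + 1 - π.card) : ℝ)) := hrow
          _ ≤ Bv * β := mul_le_mul_of_nonneg_left (hdX.le.trans hβm) hBv
          _ ≤ Bv * (Ψ + β) := mul_le_mul_of_nonneg_left (by linarith) hBv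
    refine (sum_le_sum hcell).trans ?_
    rw [sum_const, nsmul_eq_mul, hstar]
    have hnonneg : 0 ≤ 2 * ((Fintype.card (PMatch m) : ℝ) / Fintype.card (PMatch n)) * (Bv * (Ψ + β)) := by
      have := add_nonneg hΨ hβ0; positivity
    have hcount : (((verts (Dk.core i)).powerset.filter (fun π => crossCount π (Dk.core i) = 0)).card : ℝ) ≤ (4 : ℝ) ^ q :=
      calc (((verts (Dk.core i)).powerset.filter (fun π => crossCount π (Dk.core i) = 0)).card : ℝ)
          ≤ ((verts (Dk.core i)).powerset.card : ℝ) := by exact_mod_cast card_filter_le _ _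
        _ = (2 : ℝ) ^ (2 * (Dk.core i).card) := by rw [card_powerset, hVcard]; push_cast; ring
        _ = (4 : ℝ) ^ (Dk.core i).card := by rw [pow_mul]; norm_num
        _ ≤ (4 : ℝ) ^ q := pow_le_pow_right₀ (by norm_num) hSq
    calc (((verts (Dk.core i)).powerset.filter (fun π => crossCount π (Dk.core i) = 0)).card : ℝ) *
          (2 * ((Fintype.card (PMatch m) : ℝ) / Fintype.card (PMatch n)) * (Bv * (Ψ + β)))
        ≤ (4 : ℝ) ^ q * (2 * ((Fintype.card (PMatch m) : ℝ) / Fintype.card (PMatch n)) * (Bv * (Ψ + β))) :=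
          mul_le_mul_of_nonneg_right hcount hnonneg
      _ = _ := by ring
  -- CROSSING patterns (as in the tight-free rung: the crossing-pin lemma needs no tightness)
  have hcr : ∑ π ∈ (verts (Dk.core i)).powerset.filter (fun π => ¬crossCount π (Dk.core i) = 0),
      ∑ U ∈ A.filter (fun U => U.1 ∩ verts (Dk.core i) = π), ∑ M ∈ Y.filter (fun M => M.1 ∈ Dk.piece i),
        levelWeight n (2 * c' + 1) C w U M ≤ (4 : ℝ) ^ q * (Bv * Real.sqrt P) := by
    have hcell : ∀ π ∈ (verts (Dk.core i)).powerset.filter (fun π => ¬crossCount π (Dk.core i) = 0),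
        ∑ U ∈ A.filter (fun U => U.1 ∩ verts (Dk.core i) = π), ∑ M ∈ Y.filter (fun M => M.1 ∈ Dk.piece i),
          levelWeight n (2 * c' + 1) C w U M ≤ Bv * Real.sqrt P := by
      intro π hπ
      obtain ⟨-, hπ0⟩ := mem_filter.1 hπ
      obtain ⟨e, he⟩ : ((Dk.core i).filter (Crosses π)).Nonempty := by
        rw [nonempty_iff_ne_empty]; intro h0; exact hπ0 (by rw [crossCount, h0, card_empty])
      obtain ⟨heS, hecr⟩ := mem_filter.1 he
      have key : ∀ e' ∈ Dk.core i, Crosses π e' →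
          |∑ U ∈ A.filter (fun U => U.1 ∩ verts (Dk.core i) = π), ∑ M ∈ Y.filter (fun M => M.1 ∈ Dk.piece i),
            levelWeight n (2 * c' + 1) C w U M| ≤
          Bv * Real.sqrt (P * ((((A.filter fun U => U.1 ∩ verts (Dk.core i) = π).card : ℝ) / (n.choose (2 * c' + 1) : ℝ)) *
            (((Y.filter fun M => M.1 ∈ Dk.piece i).card : ℝ) / (Fintype.card (PMatch n) : ℝ)))) := by
        intro e'
        induction e' using Sym2.ind with
        | h a b =>
          intro he' hcr'
          have hab : a ∈ verts (Dk.core i) ∧ b ∈ verts (Dk.core i) := Finset.mk_mem_sym2_iff.1 (hS.1 he')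
          have h := abs_crossing_cell_le hn hdes hDg hDg4 hab.1 hab.2 hcr' A hA (Y.filter fun M => M.1 ∈ Dk.piece i)
            (fun M hM => hBiS M hM he')
          rwa [mul_assoc] at h
      refine (le_abs_self _).trans ((key e heS hecr).trans (mul_le_mul_of_nonneg_left (Real.sqrt_le_sqrt ?_) hBv))
      have hμ1 : (((A.filter fun U => U.1 ∩ verts (Dk.core i) = π).card : ℝ) / (n.choose (2 * c' + 1) : ℝ)) ≤ 1 := by
        rw [div_le_one hCn, ← card_tcuts_eq_choose (n := n) ⟨c', rfl⟩]
        exact_mod_cast card_le_card fun U hU => by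
          rw [mem_filter] at hU ⊢; exact ⟨mem_univ _, hA U hU.1⟩
      have hν1 : (((Y.filter fun M => M.1 ∈ Dk.piece i).card : ℝ) / (Fintype.card (PMatch n) : ℝ)) ≤ 1 := by
        rw [div_le_one hPM]
        exact_mod_cast (card_le_univ _).trans_eq Finset.card_univ
      calc P * (((((A.filter fun U => U.1 ∩ verts (Dk.core i) = π).card : ℝ) / (n.choose (2 * c' + 1) : ℝ)) *
            (((Y.filter fun M => M.1 ∈ Dk.piece i).card : ℝ) / (Fintype.card (PMatch n) : ℝ))))
          ≤ P * (1 * 1) := by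
            refine mul_le_mul_of_nonneg_left (mul_le_mul hμ1 hν1 (by positivity) zero_le_one) hP0
        _ = P := by ring
    refine (sum_le_sum hcell).trans ?_
    rw [sum_const, nsmul_eq_mul]
    refine mul_le_mul_of_nonneg_right ?_ (by positivity)
    calc (((verts (Dk.core i)).powerset.filter (fun π => ¬crossCount π (Dk.core i) = 0)).card : ℝ)
        ≤ ((verts (Dk.core i)).powerset.card : ℝ) := by exact_mod_cast card_filter_le _ _
      _ = (2 : ℝ) ^ (2 * (Dk.core i).card) := by rw [card_powerset, hVcard]; push_cast; ring
      _ = (4 : ℝ) ^ (Dk.core i).card := by rw [pow_mul]; norm_num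
      _ ≤ (4 : ℝ) ^ q := pow_le_pow_right₀ (by norm_num) hSq
  linarith [hnc, hcr]

end Summit.PneNP.PneNP.Theorems.ChebyshevTracialDesignRungPiecesOneSided
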